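import Mathlib
import HarnessLib
import Summits.HubbardSuperconductivity.HubbardSuperconductivity.Theorems.ComplexGFFStiffnessHolomorphicFreeHtEngines
import Summits.HubbardSuperconductivity.HubbardSuperconductivity.Theorems.ComplexGFFStiffnessFreeHtBall
import Literature.MathematicalPhysics.StatisticalMechanics.AbkmPackageNextHTwoKernel
import Literature.MathematicalPhysics.StatisticalMechanics.AbkmPackageNextHSecondDiff

/-!
# Crux child `TwoKernelSkBound` (stmt-HubbardSuperconductivity-27414), line `banach_two_kernel`, stub `stub_f4l2ShrinkLoc` —
# block B1, EXCESS part: `Ψ(H̃_{q+y+z}) − Ψ(H̃_{q+y} + H̃_{q+z} − H̃_q)` is `O(|y|₁|z|₁ max(‖u‖,c_v))`, `N`-free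

Route `route-HubbardSuperconductivity-ComplexGFFStiffness`; memo `Cruxes/HypACumulant/TWOKERNEL-PLAN-27414-v3.md` §0/§2 (R3).  Block B1
of the four-corner split is the `H̃`-"parallelogram" of `Ψ(H̃) = nextK D_{q+y+z}.s π (stepMeasure D_{q+y+z}.𝒞) (e^{−toHam u}) (e^{−H̃}) (mulExt v)`
over the corners `H̃_{q+y+z}, H̃_{q+y}, H̃_{q+z}, H̃_q`, which are NOT an exact parallelogram: the excess
`ε = H̃_{q+y+z} − H̃_{q+y} − H̃_{q+z} + H̃_q` has `‖ε‖_{k,0} ≤ ℓ_HH|y|₁|z|₁max(‖u‖,c_v)` (p831100).  This file bounds the EXCESS TERM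
`Ψ(H̃_{q+y+z}) − Ψ(H̃_{q+y} + H̃_{q+z} − H̃_q)` by the line engine `weakNormLE_sub_nextK_freeHt_line_package` (p833074) along
`(H̃_{q+y} + H̃_{q+z} − H̃_q) + σε` with radius `ρ₀/(4‖ε‖)` and the uniform bound `M₁` of `exists_weakNormLE_nextK_freeHt_ball` (U1):
**`N`-free `l ≥ 0`, `T₂ > 0` with weak norm `≤ l·|y|₁|z|₁·max(‖u‖,c_v)`** (`exists_weakNormLE_blockB1_excess`).  The remaining exact
parallelogram `Ψ(H̃_q+δ_y+δ_z) − Ψ(H̃_q+δ_y) − Ψ(H̃_q+δ_z) + Ψ(H̃_q)` is the bidisc engine's job (next file).  All proved, no `sorry`.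
Honest scope: rung route (stiffness of a complex Gaussian gradient field via the [ABKM19] RG); nothing about superconductivity in the
Hubbard model.

## References
* S. Adams, S. Buchholz, R. Kotecký, S. Müller, arXiv:1910.13564, Definition 6.5 (6.34), Theorem 6.8, Lemma 12.6 (12.53)
  [AdamsBuchholzKoteckyMuller2019].
-/

noncomputable section

-- `Summit.<Summit>.<Problem>`: single-conjunct summit, the duplicate component is mandated (D-0017).
set_option linter.dupNamespace false

namespace Summit.HubbardSuperconductivity.HubbardSuperconductivity.Theorems.ComplexGFF

open MeasureTheory Metric Set
open scoped BigOperators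
open Literature.MathematicalPhysics.StatisticalMechanics.GradientRG
open Literature.MathematicalPhysics.StatisticalMechanics.TorusPolymer (IsPolymer blockOf reblock)
open Literature.Barriers.CriticalPhenomena.LongRangePhi4.Polymer (IsConn)
open Literature.MathematicalPhysics.StatisticalMechanics

variable {d : ℕ}

set_option maxHeartbeats 1600000 in
/-- **Block B1, excess part, `N`-free** (module docstring). [cite: AdamsBuchholzKoteckyMuller2019, Lemma 12.6 (12.53) / Definition 6.5 (6.34)] -/
theorem exists_weakNormLE_blockB1_excess (P : PackageData d) [Fact (0 < P.h)] [Fact (0 < P.L)] (hr0 : 0 < P.r) :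
    ∃ l T₂ : ℝ, 0 ≤ l ∧ 0 < T₂ ∧ ∀ (N M : ℕ) [NeZero M] (Q : PackageAt P N M),
      ∀ q y z : Matrix (Fin d) (Fin d) ℝ, P.InBall q → P.InBall (q + y) → P.InBall (q + z) → P.InBall (q + y + z) →
      esum y ≤ T₂ → esum z ≤ T₂ → ∀ k, k + 1 ≤ N →
      ∀ (u : HamSpace ℂ d (fieldWt P.h (P.L : ℝ) d k) ((P.L : ℝ) ^ k) (P.L ^ (d * k)))
        (v : activitySpace Q.normParams k) (cv : ℝ), ‖u‖ ≤ P.r →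
        activityNormLE Q.normParams k v cv → cv ≤ P.r →
      WeakNormLE Q.normParams (k + 1)
        (fun X ψ =>
          nextK (abkmStepData P.L P.R k (Q.kernels (q + y + z))).s
              (reblock (abkmStepData P.L P.R k (Q.kernels (q + y + z))).s
                ((abkmStepData P.L P.R k (Q.kernels (q + y + z))).L * (abkmStepData P.L P.R k (Q.kernels (q + y + z))).s))
              (stepMeasure (abkmStepData P.L P.R k (Q.kernels (q + y + z))).𝒞) (expNegH (HamSpace.toHam u))
              (expNegH (nextH (abkmStepData P.L P.R k (Q.kernels (q + y + z))) (HamSpace.toHam u)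
                (mulExt ((v : activitySpace Q.normParams k) : Finset (Fin d → ZMod M) → ((Fin d → ZMod M) → ℝ) → ℂ))))
              (mulExt ((v : activitySpace Q.normParams k) : Finset (Fin d → ZMod M) → ((Fin d → ZMod M) → ℝ) → ℂ)) X ψ -
          nextK (abkmStepData P.L P.R k (Q.kernels (q + y + z))).s
              (reblock (abkmStepData P.L P.R k (Q.kernels (q + y + z))).s
                ((abkmStepData P.L P.R k (Q.kernels (q + y + z))).L * (abkmStepData P.L P.R k (Q.kernels (q + y + z))).s))
              (stepMeasure (abkmStepData P.L P.R k (Q.kernels (q + y + z))).𝒞) (expNegH (HamSpace.toHam u))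
              (expNegH (nextH (abkmStepData P.L P.R k (Q.kernels (q + y))) (HamSpace.toHam u)
                (mulExt ((v : activitySpace Q.normParams k) : Finset (Fin d → ZMod M) → ((Fin d → ZMod M) → ℝ) → ℂ)) +
              nextH (abkmStepData P.L P.R k (Q.kernels (q + z))) (HamSpace.toHam u)
                (mulExt ((v : activitySpace Q.normParams k) : Finset (Fin d → ZMod M) → ((Fin d → ZMod M) → ℝ) → ℂ)) -
              nextH (abkmStepData P.L P.R k (Q.kernels q)) (HamSpace.toHam u)
                (mulExt ((v : activitySpace Q.normParams k) : Finset (Fin d → ZMod M) → ((Fin d → ZMod M) → ℝ) → ℂ))))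
              (mulExt ((v : activitySpace Q.normParams k) : Finset (Fin d → ZMod M) → ((Fin d → ZMod M) → ℝ) → ℂ)) X ψ)
        (l * esum y * esum z * max ‖u‖ cv) := by
  obtain ⟨M₁, ρ₀, hM₁, hρ₀, hU1⟩ := exists_weakNormLE_nextK_freeHt_ball P hr0
  obtain ⟨ℓHH, hℓHH0, hsec⟩ := P.exists_hamNorm_nextH_secondDiff
  -- the threshold: `ℓ_HH T₂ r ≤ ρ₀/16`, `T₂ ≤ 1`
  set T₂ : ℝ := min 1 (ρ₀ / (16 * (ℓHH + 1) * (P.r + 1))) with hT₂def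
  have hT₂0 : 0 < T₂ := lt_min one_pos (by positivity)
  have hT₂1 : T₂ ≤ 1 := min_le_left _ _
  have hT₂ρ : ℓHH * T₂ * P.r ≤ ρ₀ / 16 := by
    have h1 : T₂ ≤ ρ₀ / (16 * (ℓHH + 1) * (P.r + 1)) := min_le_right _ _
    have h2 : ℓHH * T₂ * P.r ≤ (ℓHH + 1) * (ρ₀ / (16 * (ℓHH + 1) * (P.r + 1))) * (P.r + 1) :=
      mul_le_mul (mul_le_mul (by linarith : ℓHH ≤ ℓHH + 1) h1 hT₂0.le (by linarith))
        (by linarith : P.r ≤ P.r + 1) P.hr0 (by positivity)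
    have h3 : (ℓHH + 1) * (ρ₀ / (16 * (ℓHH + 1) * (P.r + 1))) * (P.r + 1) = ρ₀ / 16 := by
      field_simp
    linarith [h2, h3.le]
  set l : ℝ := ((P.r₀ : ℝ) + 1) * 8 * M₁ * ℓHH / ρ₀ with hldef
  have hl0 : 0 ≤ l := by rw [hldef]; positivity
  refine ⟨l, T₂, hl0, hT₂0, fun N M _ Q => ?_⟩
  intro q y z hq hqy hqz hqyz hy hz k hk u v cv hu hv hcv
  -- sizes and the state
  have hPA : 0 < Q.normParams.A := P.A_pos
  have hL0r : (0 : ℝ) < P.L := by exact_mod_cast P.hLodd.pos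
  have h𝔥 : 0 < fieldWt P.h (P.L : ℝ) d k := fieldWt_pos P.hh hL0r d k
  have hRk : (0 : ℝ) < (P.L : ℝ) ^ k := pow_pos hL0r k
  have hnpos : 0 < P.L ^ (d * k) := pow_pos P.hLodd.pos _
  have hnn : ∀ G : RelevantHamiltonian ℂ d, 0 ≤ hamNorm (fieldWt P.h (P.L : ℝ) d k) ((P.L : ℝ) ^ k) (P.L ^ (d * k)) G :=
    fun G => hamNorm_nonneg h𝔥.le hRk.le _ _
  have hMt : M = Q.normParams.L ^ k * P.L ^ (N - k) := by
    show M = P.L ^ k * P.L ^ (N - k)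
    rw [Q.hM, ← pow_add, Nat.add_sub_cancel' (by omega)]
  have hcv0 : 0 ≤ cv := nonneg_of_weakNormLE hPA hMt P.hLodd.pow P.hLodd.pow hv
  set mx := max ‖u‖ cv with hmxdef
  have hmx0 : 0 ≤ mx := le_max_of_le_left (norm_nonneg _)
  have hmxr : mx ≤ P.r := max_le hu hcv
  have hy0 : 0 ≤ esum y := entrySum_nonneg _
  have hz0 : 0 ≤ esum z := entrySum_nonneg _
  set H := HamSpace.toHam u with hHdef
  set Kf := mulExt ((v : activitySpace Q.normParams k) :
    Finset (Fin d → ZMod M) → ((Fin d → ZMod M) → ℝ) → ℂ) with hKfdef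
  have hnormu : hamNorm (fieldWt P.h (P.L : ℝ) d k) ((P.L : ℝ) ^ k) (P.L ^ (d * k)) H = ‖u‖ := by
    rw [hHdef, HamSpace.norm_def]
  have hH8 : hamNorm (fieldWt P.h (P.L : ℝ) d k) ((P.L : ℝ) ^ k) (P.L ^ (d * k)) H ≤ 1 / 8 := by
    rw [hnormu]; exact hu.trans (P.hr.trans (by norm_num))
  have hva : WeakNormLE Q.normParams k ((v : activitySpace Q.normParams k) :
      Finset (Fin d → ZMod M) → ((Fin d → ZMod M) → ℝ) → ℂ) cv := hv
  set D00 := abkmStepData P.L P.R k (Q.kernels q) with hD00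
  set D10 := abkmStepData P.L P.R k (Q.kernels (q + y)) with hD10
  set D01 := abkmStepData P.L P.R k (Q.kernels (q + z)) with hD01
  set D11 := abkmStepData P.L P.R k (Q.kernels (q + y + z)) with hD11
  set Ht00 := nextH D00 H Kf with hHt00
  set Ht10 := nextH D10 H Kf with hHt10
  set Ht01 := nextH D01 H Kf with hHt01
  set Ht11 := nextH D11 H Kf with hHt11
  set ε := Ht11 - Ht10 - Ht01 + Ht00 with hεdef
  set Ht₀ := Ht10 + Ht01 - Ht00 with hHt₀
  set nε := hamNorm (fieldWt P.h (P.L : ℝ) d k) ((P.L : ℝ) ^ k) (P.L ^ (d * k)) ε with hnεdef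
  have hnε0 : 0 ≤ nε := hnn _
  -- `‖ε‖ ≤ ℓ_HH |y|₁|z|₁ mx ≤ ρ₀/16`
  have hε : nε ≤ ℓHH * esum y * esum z * mx := hsec N M Q q y z hq hqy hqz hqyz k hk u v cv hv
  have hyz : esum y * esum z ≤ T₂ := by
    calc esum y * esum z ≤ T₂ * 1 := mul_le_mul hy (hz.trans hT₂1) hz0 hT₂0.le
      _ = T₂ := mul_one _
  have hnερ : nε ≤ ρ₀ / 16 := by
    have h1 : ℓHH * esum y * esum z * mx ≤ ℓHH * T₂ * P.r := by
      have := mul_le_mul (mul_le_mul_of_nonneg_left hyz hℓHH0) hmxr hmx0 (by positivity)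
      calc ℓHH * esum y * esum z * mx = ℓHH * (esum y * esum z) * mx := by ring
        _ ≤ ℓHH * T₂ * P.r := this
    exact hε.trans (h1.trans hT₂ρ)
  have hrhs0 : 0 ≤ l * esum y * esum z * mx := by positivity
  by_cases hε0 : nε = 0
  · -- `ε = 0`: the two points coincide
    have hεz : ε = 0 := eq_zero_of_hamNorm_eq_zero h𝔥 hRk hnpos hε0
    have hHt : Ht11 = Ht10 + Ht01 - Ht00 := by
      have : Ht11 - Ht10 - Ht01 + Ht00 = 0 := hεz
      linear_combination this
    intro X hX hXc φ
    simp only [hHt, hHt₀, sub_self]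
    rw [tayNorm_const, norm_zero]
    exact mul_nonneg (mul_nonneg hrhs0 (WeakNormLE.aFactor_pos hPA (k + 1) X).le)
      ((Q.normParams.W.weight_pos (k + 1) X φ).le)
  -- `ε ≠ 0`: the line engine along `Ht₀ + σ ε` with radius `R = ρ₀ / (4‖ε‖)`
  have hnεpos : 0 < nε := lt_of_le_of_ne hnε0 (Ne.symm hε0)
  set R : ℝ := ρ₀ / (4 * nε) with hRdef
  have hR0 : 0 < R := by positivity
  have hRnε : R * nε = ρ₀ / 4 := by rw [hRdef]; field_simp
  have hR1 : (1 : ℂ) ∈ ball (0 : ℂ) R := by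
    rw [mem_ball_zero_iff, norm_one, hRdef, lt_div_iff₀ (by positivity)]
    linarith [hnερ]
  -- the uniform bound on the disc (U1)
  have hG : ∀ σ ∈ ball (0 : ℂ) R, WeakNormLE Q.normParams (k + 1)
      (fun X ψ => nextK D11.s (reblock D11.s (D11.L * D11.s)) (stepMeasure D11.𝒞) (expNegH H) (expNegH (Ht₀ + σ • ε)) Kf X ψ)
      M₁ := by
    intro σ hσ
    have hσ' : ‖σ‖ ≤ R := le_of_lt (mem_ball_zero_iff.1 hσ)
    refine hU1 N M Q (q + y + z) hqyz k hk u v cv hu hv hcv (Ht₀ + σ • ε) ?_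
    have e : Ht₀ + σ • ε - nextH D11 H Kf = (-ε) + σ • ε := by
      rw [hHt₀, hεdef, hHt11]; abel
    rw [e]
    have h1 := hamNorm_add_le h𝔥.le hRk.le (P.L ^ (d * k)) (-ε) (σ • ε)
    rw [hamNorm_neg, hamNorm_complex_smul] at h1
    have h3 : ‖σ‖ * nε ≤ ρ₀ / 4 := by
      calc ‖σ‖ * nε ≤ R * nε := mul_le_mul_of_nonneg_right hσ' hnε0
        _ = ρ₀ / 4 := hRnε
    linarith [h1, h3, hnερ]
  have hE := weakNormLE_sub_nextK_freeHt_line_package P Q (q := q + y + z) hqyz hk hH8 hcv0 hva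
    (fun Y => activitySpace.contDiff v Y) (fun Y hY hYc => activitySpace.isGaugeLocal v hY hYc) Ht₀ ε hG hR1
  -- identify the points and bound the constant
  have e1 : Ht₀ + (1 : ℂ) • ε = Ht11 := by rw [one_smul, hHt₀, hεdef]; abel
  have e0 : Ht₀ + (0 : ℂ) • ε = Ht10 + Ht01 - Ht00 := by rw [zero_smul, add_zero]
  rw [e1, e0] at hE
  refine hE.mono hPA ?_
  rw [norm_one, mul_one]
  have hRinv : 2 * M₁ / R = 8 * M₁ * nε / ρ₀ := by
    rw [hRdef]; field_simp; ring
  rw [hRinv]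
  have hkey : ((P.r₀ : ℝ) + 1) * (8 * M₁ * nε / ρ₀) ≤
      ((P.r₀ : ℝ) + 1) * (8 * M₁ * (ℓHH * esum y * esum z * mx) / ρ₀) := by
    have h2 : 8 * M₁ * nε ≤ 8 * M₁ * (ℓHH * esum y * esum z * mx) := mul_le_mul_of_nonneg_left hε (by positivity)
    exact mul_le_mul_of_nonneg_left (div_le_div_of_nonneg_right h2 hρ₀.le) (by positivity)
  refine hkey.trans (le_of_eq ?_)
  rw [hldef]
  field_simp

end Summit.HubbardSuperconductivity.HubbardSuperconductivity.Theorems.ComplexGFF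

end
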